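import Summits.CriticalPhenomena.PercolationContinuityZ3.Theorems.PercNearOneGluingNoHeavyLowerTailApexForestPreFKG
import HarnessLib

/-!
# Kozma–Nitzan CONJECTURE 2 on APEX-FOREST graphs — the packaged theorems
# (`NoHeavyLowerTail` cell, stmt-CriticalPhenomena-4575; new-inequality factory seat `prim-ineq-gen-7`, gen 4)

Support file (`--supports stmt-CriticalPhenomena-4575`); no definitions, no named facts, no sorries.  Corollaries of the forest induction `ApexForest.preFKG_aux`
(`…ApexForestPreFKG`); paper proof run/shared/lean/prim/prim-ineq-gen-7/PROOF-CONJ2-APEXFOREST.md.  THEOREM 2 of the seat, strictly stronger than THEOREM 1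
(`ApexForest.conj1`, `…ApexForestConjectureOne`): by Harris `μ(α ↮ c, o ↔ A∪c) ≤ μ(α ↮ c)·μ(o ↔ A∪c)`.

SETTING (apex-forest instance): vertices `Fin n`, weights `w` (`μ = prodBernoulli w`), hub `c`, `D` a finite set of pairs avoiding `c` with `fromEdgeSet D` ACYCLIC, all pairs
outside `D` not containing `c` of weight `0` (`G − c` a forest, hub pairs arbitrary); `A` nonempty, `o ≠ c`.

* `ApexForest.preFKG` — **`∃ α ∈ A, μ(o ↔ A, o ↮ c) ≤ μ(α ↮ c, o ↔ A ∪ {c})`** ((3⁺) of the paper proof).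
* `ApexForest.kn3` — **Kozma–Nitzan's inequality (3) for the relay set `A ∪ {c}`**: `∃ α ∈ A, μ(o ↔ A ∪ {c}, α ↔ c) ≤ μ(o ↔ c)`.
* `ApexForest.conj2` — **KOZMA–NITZAN CONJECTURE 2 (pre-FKG) on apex-forests**: `min_{a∈A} μ(o ↔ A, a ↔ c) ≤ μ(o ↔ c)`, all `|A|`, depths, branchings
  (in print: Theorem 1 = the case `|A| = 2`).
[cite: KozmaNitzan2024, Conjecture 2 and (3) (p. 3); Theorem 1] [cite: Grimmett1999, §1.3, §2.2]
-/

namespace Summit.CriticalPhenomena.PercolationContinuityZ3.Theorems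

namespace ApexForest

open MeasureTheory Set Literature.Probability.LatticeModels Literature.Probability.Percolation
open scoped Classical

variable {n : ℕ}

/-- **(3⁺) on apex-forests**: some relay `α ∈ A` satisfies `μ(o ↔ A, o ↮ c) ≤ μ(α ↮ c, o ↔ A ∪ {c})`. [cite: KozmaNitzan2024, (3) (p. 3)] -/
theorem preFKG (w : Sym2 (Fin n) → unitInterval) (c : Fin n) (D : Finset (Sym2 (Fin n)))
    (hDc : ∀ p ∈ D, c ∉ p) (hacyc : (SimpleGraph.fromEdgeSet (↑D : Set (Sym2 (Fin n)))).IsAcyclic)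
    (hw : ∀ p : Sym2 (Fin n), p ∉ D → c ∉ p → (w p : ℝ) = 0)
    (A : Finset (Fin n)) (hA : A.Nonempty) (o : Fin n) (hoc : o ≠ c) :
    ∃ α ∈ A, (prodBernoulli w).real ((⋃ a ∈ A, (openConn o a : Set (BondConfig (Fin n)))) ∩ (openConn o c : Set (BondConfig (Fin n)))ᶜ) ≤
      (prodBernoulli w).real ((openConn α c : Set (BondConfig (Fin n)))ᶜ ∩ ⋃ a ∈ insert c A, (openConn o a : Set (BondConfig (Fin n)))) := by
  obtain ⟨α, hαA, hle⟩ := preFKG_aux D.card D w c o A rfl hDc hacyc hw hoc hA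
  refine ⟨α, hαA, ?_⟩
  have hX : (prodBernoulli w).real ((⋃ a ∈ A, (openConn o a : Set (BondConfig (Fin n)))) ∩ (openConn o c : Set (BondConfig (Fin n)))ᶜ) =
      (prodBernoulli w).real (openConn o c : Set (BondConfig (Fin n)))ᶜ -
        (prodBernoulli w).real ((openConn o c : Set (BondConfig (Fin n)))ᶜ ∩
          (⋃ a ∈ A, (openConn o a : Set (BondConfig (Fin n))))ᶜ) := by
    have h1 : (prodBernoulli w).real ((openConn o c : Set (BondConfig (Fin n)))ᶜ ∩ ⋃ a ∈ A, (openConn o a : Set (BondConfig (Fin n)))) +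
        (prodBernoulli w).real ((openConn o c : Set (BondConfig (Fin n)))ᶜ \ ⋃ a ∈ A, (openConn o a : Set (BondConfig (Fin n)))) =
        (prodBernoulli w).real (openConn o c : Set (BondConfig (Fin n)))ᶜ :=
      measureReal_inter_add_sdiff MeasurableSet.of_discrete (measure_ne_top _ _)
    rw [Set.sdiff_eq] at h1
    rw [Set.inter_comm]
    linarith
  have hY : (prodBernoulli w).real ((openConn α c : Set (BondConfig (Fin n)))ᶜ ∩ ⋃ a ∈ insert c A, (openConn o a : Set (BondConfig (Fin n)))) =
      (prodBernoulli w).real (openConn α c : Set (BondConfig (Fin n)))ᶜ -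
        (prodBernoulli w).real (((openConn o c : Set (BondConfig (Fin n)))ᶜ ∩
          (⋃ a ∈ A, (openConn o a : Set (BondConfig (Fin n))))ᶜ) ∩ (openConn α c : Set (BondConfig (Fin n)))ᶜ) := by
    have h1 : (prodBernoulli w).real ((openConn α c : Set (BondConfig (Fin n)))ᶜ ∩ ⋃ a ∈ insert c A, (openConn o a : Set (BondConfig (Fin n)))) +
        (prodBernoulli w).real ((openConn α c : Set (BondConfig (Fin n)))ᶜ \ ⋃ a ∈ insert c A, (openConn o a : Set (BondConfig (Fin n)))) =
        (prodBernoulli w).real (openConn α c : Set (BondConfig (Fin n)))ᶜ :=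
      measureReal_inter_add_sdiff MeasurableSet.of_discrete (measure_ne_top _ _)
    have h2 : (openConn α c : Set (BondConfig (Fin n)))ᶜ \ (⋃ a ∈ insert c A, (openConn o a : Set (BondConfig (Fin n)))) =
        ((openConn o c : Set (BondConfig (Fin n)))ᶜ ∩ (⋃ a ∈ A, (openConn o a : Set (BondConfig (Fin n))))ᶜ) ∩
          (openConn α c : Set (BondConfig (Fin n)))ᶜ := by
      rw [Finset.set_biUnion_insert, Set.sdiff_eq, Set.compl_union, Set.inter_comm]
    rw [h2] at h1
    linarith
  rw [hX, hY]
  exact hle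

/-- **Kozma–Nitzan's inequality (3) for the relay set `A ∪ {c}` on apex-forests**: `∃ α ∈ A, μ(o ↔ A ∪ {c}, α ↔ c) ≤ μ(o ↔ c)`.
[cite: KozmaNitzan2024, (3) (p. 3)] -/
theorem kn3 (w : Sym2 (Fin n) → unitInterval) (c : Fin n) (D : Finset (Sym2 (Fin n)))
    (hDc : ∀ p ∈ D, c ∉ p) (hacyc : (SimpleGraph.fromEdgeSet (↑D : Set (Sym2 (Fin n)))).IsAcyclic)
    (hw : ∀ p : Sym2 (Fin n), p ∉ D → c ∉ p → (w p : ℝ) = 0)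
    (A : Finset (Fin n)) (hA : A.Nonempty) (o : Fin n) (hoc : o ≠ c) :
    ∃ α ∈ A, (prodBernoulli w).real ((⋃ a ∈ insert c A, (openConn o a : Set (BondConfig (Fin n)))) ∩ (openConn α c : Set (BondConfig (Fin n)))) ≤
      (prodBernoulli w).real (openConn o c : Set (BondConfig (Fin n))) := by
  obtain ⟨α, hαA, hle⟩ := preFKG w c D hDc hacyc hw A hA o hoc
  refine ⟨α, hαA, ?_⟩
  -- `μ(⋃_{A∪c}) = μ(o ↔ c) + μ(o ↔ A, o ↮ c)` and `μ(⋃_{A∪c}) = μ(⋃_{A∪c}, α ↔ c) + μ(⋃_{A∪c}, α ↮ c)`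
  have h1 : (prodBernoulli w).real ((⋃ a ∈ insert c A, (openConn o a : Set (BondConfig (Fin n)))) ∩ (openConn o c : Set (BondConfig (Fin n)))) +
      (prodBernoulli w).real ((⋃ a ∈ insert c A, (openConn o a : Set (BondConfig (Fin n)))) \ (openConn o c : Set (BondConfig (Fin n)))) =
      (prodBernoulli w).real (⋃ a ∈ insert c A, (openConn o a : Set (BondConfig (Fin n)))) :=
    measureReal_inter_add_sdiff MeasurableSet.of_discrete (measure_ne_top _ _)
  have h1a : (⋃ a ∈ insert c A, (openConn o a : Set (BondConfig (Fin n)))) ∩ (openConn o c : Set (BondConfig (Fin n))) =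
      (openConn o c : Set (BondConfig (Fin n))) := by
    rw [Finset.set_biUnion_insert]
    exact Set.inter_eq_right.2 Set.subset_union_left
  have h1b : (⋃ a ∈ insert c A, (openConn o a : Set (BondConfig (Fin n)))) \ (openConn o c : Set (BondConfig (Fin n))) =
      (⋃ a ∈ A, (openConn o a : Set (BondConfig (Fin n)))) ∩ (openConn o c : Set (BondConfig (Fin n)))ᶜ := by
    rw [Finset.set_biUnion_insert, Set.union_sdiff_left, Set.sdiff_eq]
  rw [h1a, h1b] at h1
  have h2 : (prodBernoulli w).real ((⋃ a ∈ insert c A, (openConn o a : Set (BondConfig (Fin n)))) ∩ (openConn α c : Set (BondConfig (Fin n)))) +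
      (prodBernoulli w).real ((⋃ a ∈ insert c A, (openConn o a : Set (BondConfig (Fin n)))) \ (openConn α c : Set (BondConfig (Fin n)))) =
      (prodBernoulli w).real (⋃ a ∈ insert c A, (openConn o a : Set (BondConfig (Fin n)))) :=
    measureReal_inter_add_sdiff MeasurableSet.of_discrete (measure_ne_top _ _)
  rw [Set.sdiff_eq, Set.inter_comm _ (openConn α c : Set (BondConfig (Fin n)))ᶜ] at h2
  linarith

/-- **KOZMA–NITZAN CONJECTURE 2 (pre-FKG) on apex-forest graphs**: if `G − c` is a forest then for every `o ≠ c` and nonempty `A`,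
`min_{a∈A} P(o ↔ A, a ↔ c) ≤ P(o ↔ c)` — proved in print for `|A| = 2` (their Theorem 1); here for the whole class, all `|A|`, all depths and branchings.
[cite: KozmaNitzan2024, Conjecture 2 (p. 3)] -/
theorem conj2 (w : Sym2 (Fin n) → unitInterval) (c : Fin n) (D : Finset (Sym2 (Fin n)))
    (hDc : ∀ p ∈ D, c ∉ p) (hacyc : (SimpleGraph.fromEdgeSet (↑D : Set (Sym2 (Fin n)))).IsAcyclic)
    (hw : ∀ p : Sym2 (Fin n), p ∉ D → c ∉ p → (w p : ℝ) = 0)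
    (A : Finset (Fin n)) (hA : A.Nonempty) (o : Fin n) (hoc : o ≠ c) :
    A.inf' hA (fun a => (prodBernoulli w).real ((⋃ a' ∈ A, (openConn o a' : Set (BondConfig (Fin n)))) ∩ (openConn a c : Set (BondConfig (Fin n))))) ≤
      (prodBernoulli w).real (openConn o c : Set (BondConfig (Fin n))) := by
  obtain ⟨α, hαA, hle⟩ := kn3 w c D hDc hacyc hw A hA o hoc
  refine (Finset.inf'_le _ hαA).trans (le_trans (measureReal_mono ?_) hle)
  rw [Finset.set_biUnion_insert]
  exact Set.inter_subset_inter_left _ Set.subset_union_right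

end ApexForest

end Summit.CriticalPhenomena.PercolationContinuityZ3.Theorems
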